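import Literature.NumberTheory.EllipticCurves.SingularCubic
import HarnessLib

/-!
# The singular model under ring homomorphisms: functoriality of the node map, uniqueness of the
# singular point, and automorphisms fixing the curve (Silverman *AEC* III.2.5, Exercise 3.5)

Sibling proof file (theorems only) of `SingularCubic` (`WeierstrassCurve.singularModel x₀ y₀ α₁ α₂`,
the general Weierstrass cubic with a singular point `S = (x₀, y₀)` and tangent slopes `α₁, α₂`,
and Silverman's node map `nodeFun`/`nodeHom`, `(x, y) ↦ (y - α₁x - β₁)/(y - α₂x - β₂)`).  It
records how these objects move under a ring homomorphism `f : k → k₂` of fields — the algebra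
behind the Galois behaviour of `Ẽ_ns(k̄) ≅ k̄ˣ` at a node (Silverman, *AEC*, Exercise 3.5(a):
split node, `ψ` commutes with `Gal(k̄/k)`; non-split node, the Galois group swaps the tangent
lines and `ψ(P^σ) = σ(ψ P)⁻¹`), used for the (anti-)equivariance of `ψ ∘ reduction` in the
torsion-point forms of Serre–Tate's Lemma 2 (`HasseWeilAbelianEulerFactorTorsionProofs`):

* `singularModel.map_eq`, `singularModel.swap_eq`: `(singularModel x₀ y₀ α₁ α₂).map f` is the
  singular model of the `f`-images; the model is symmetric in `α₁, α₂`;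
* `singularModel.nodeFun_map_some`: **`ψ` commutes with `f`**:
  `ψ_{f x₀, f y₀, f α₁, f α₂}(f x, f y) = f (ψ_{x₀, y₀, α₁, α₂}(x, y))`;
  `singularModel.nodeFun_swap_some`: **swapping the slopes inverts `ψ`**;
* `singularModel.eq_of_equation_of_not_nonsingular`: **`S` is the only singular point** of the
  singular model (every other point of the cubic is a `P(m)`, `m ∉ {α₁, α₂}`, which is
  non-singular — `SingularCubic.nonsingular_pt`);
* `singularModel.apply_eq_of_map_eq` (**main**): if an endomorphism `g` of the field `k` fixes the
  curve, `(singularModel x₀ y₀ α₁ α₂).map g = singularModel x₀ y₀ α₁ α₂` (e.g. the Frobenius of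
  `k̄_v` on the reduction of a `K_v`-rational equation), then **`g` fixes the singular point and
  either fixes both tangent slopes or swaps them**: `g x₀ = x₀`, `g y₀ = y₀`, and
  `(g α₁ = α₁ ∧ g α₂ = α₂) ∨ (g α₁ = α₂ ∧ g α₂ = α₁)` (uniqueness of the singular point; the slopes
  are the roots of the tangent cone `T² + a₁T - (a₂ + 3x₀)`).

## References

* J. H. Silverman, *The Arithmetic of Elliptic Curves*, 2nd ed. (2009), Prop. III.1.4(a),
  Prop. III.2.5 and its proof, Exercise 3.5(a) (PDF pp. 59, 97). [SilvermanAEC2009]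

## Design

Theorems only, in `namespace WeierstrassCurve.singularModel` (dot-notation extensions as in
`SingularCubic`); statements at the level of coordinates (`Affine.Point.some x y h`), which is
the form in which reductions of points are computed (`WeierstrassCurve.reducePoint`).
-/

noncomputable section

universe u v

namespace WeierstrassCurve

namespace singularModel

variable {k : Type u} [Field k] {k₂ : Type v} [Field k₂] (f : k →+* k₂) (x₀ y₀ α₁ α₂ : k)

/-- The singular model is functorial in its four parameters: mapping the coefficients along a
ring homomorphism `f` gives the singular model of the `f`-images. [folklore] -/
theorem map_eq : (singularModel x₀ y₀ α₁ α₂).map f = singularModel (f x₀) (f y₀) (f α₁) (f α₂) := by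
  ext <;> simp [singularModel, map, map_ofNat]

/-- The singular model is symmetric in the two tangent slopes. [folklore] -/
theorem swap_eq : singularModel x₀ y₀ α₂ α₁ = singularModel x₀ y₀ α₁ α₂ := by
  ext <;> simp only [singularModel] <;> ring

variable {x₀ y₀ α₁ α₂}

/-- A point `(x, y)` of the singular model maps to the point `(f x, f y)` of the singular model of
the `f`-images (equation and non-singularity are preserved by the injective `f`). [folklore] -/
theorem nonsingular_map {x y : k} (h : (singularModel x₀ y₀ α₁ α₂).toAffine.Nonsingular x y) :
    (singularModel (f x₀) (f y₀) (f α₁) (f α₂)).toAffine.Nonsingular (f x) (f y) := by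
  rw [← map_eq]
  exact (Affine.map_nonsingular _ f.injective x y).mpr h

/-- **The node map commutes with ring homomorphisms**:
`ψ_{f x₀, f y₀, f α₁, f α₂}(f x, f y) = f (ψ_{x₀, y₀, α₁, α₂}(x, y))`.  With `f` an endomorphism
fixing the four parameters (a split node and its Frobenius) this is the equivariance of `ψ`;
Silverman, *AEC*, Prop. III.2.5(a), Exercise 3.5(a)(i).
[cite: SilvermanAEC2009, Prop. III.2.5(a) and Exercise 3.5(a) (PDF pp. 59, 97)] -/
theorem nodeFun_map_some {x y : k} (h : (singularModel x₀ y₀ α₁ α₂).toAffine.Nonsingular x y) :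
    nodeFun (f x₀) (f y₀) (f α₁) (f α₂) (.some _ _ (nonsingular_map f h)) =
      f (nodeFun x₀ y₀ α₁ α₂ (.some _ _ h)) := by
  simp only [nodeFun, map_div₀, map_sub, map_mul]

/-- Transport of non-singularity across the swap of the slopes. [folklore] -/
theorem nonsingular_swap {x y : k} (h : (singularModel x₀ y₀ α₁ α₂).toAffine.Nonsingular x y) :
    (singularModel x₀ y₀ α₂ α₁).toAffine.Nonsingular x y := by
  rwa [swap_eq]

/-- **Swapping the tangent slopes inverts the node map**:
`ψ_{x₀, y₀, α₂, α₁}(x, y) = ψ_{x₀, y₀, α₁, α₂}(x, y)⁻¹` (the same point, seen on the equal curve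
`singularModel x₀ y₀ α₂ α₁ = singularModel x₀ y₀ α₁ α₂`).  Combined with `nodeFun_map_some` for
an endomorphism swapping `α₁, α₂` (a non-split node and its Frobenius) this is the
anti-equivariance `ψ(P^σ) = σ(ψ P)⁻¹`; Silverman, *AEC*, Exercise 3.5(a)(ii).
[cite: SilvermanAEC2009, Prop. III.2.5(a) and Exercise 3.5(a) (PDF pp. 59, 97)] -/
theorem nodeFun_swap_some {x y : k} (h : (singularModel x₀ y₀ α₁ α₂).toAffine.Nonsingular x y)
    (h' : (singularModel x₀ y₀ α₂ α₁).toAffine.Nonsingular x y) :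
    nodeFun x₀ y₀ α₂ α₁ (.some _ _ h') = (nodeFun x₀ y₀ α₁ α₂ (.some _ _ h))⁻¹ := by
  simp only [nodeFun, inv_div]

/-- **`S = (x₀, y₀)` is the only singular point of the singular model** (node or cusp): a
solution `(x, y)` of the equation which is not a non-singular point is `S`.  Every other
solution lies on a line through `S` of some slope `m` and is then the point `P(m)`
(`equation_line_iff`), non-singular for `m ∉ {α₁, α₂}` (`nonsingular_pt`) and equal to `S` for
`m ∈ {α₁, α₂}`.  Silverman, *AEC*, Prop. III.1.4(a) (a singular Weierstrass cubic has exactly one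
singular point). [cite: SilvermanAEC2009, Prop. III.1.4(a) and proof of Prop. III.2.5] -/
theorem eq_of_equation_of_not_nonsingular {x y : k}
    (hE : (singularModel x₀ y₀ α₁ α₂).toAffine.Equation x y)
    (hS : ¬ (singularModel x₀ y₀ α₁ α₂).toAffine.Nonsingular x y) : x = x₀ ∧ y = y₀ := by
  by_cases hx : x = x₀
  · subst hx
    exact ⟨rfl, (equation_x₀_iff x y₀ α₁ α₂ y).mp hE⟩
  · exfalso
    have hx' : x - x₀ ≠ 0 := sub_ne_zero.mpr hx
    set m := (y - y₀) / (x - x₀) with hm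
    have hy : y = y₀ + m * (x - x₀) := by rw [hm]; field_simp; ring
    rw [hy] at hE hS
    have hline := (equation_line_iff x₀ y₀ α₁ α₂ m x).mp hE
    have hxm : x - x₀ - (m - α₁) * (m - α₂) = 0 :=
      (mul_eq_zero.mp hline).resolve_left (pow_ne_zero 2 hx')
    by_cases hmα : m ≠ α₁ ∧ m ≠ α₂
    · apply hS
      have hX : x = ptX x₀ α₁ α₂ m := by rw [ptX]; linear_combination hxm
      have hY : y₀ + m * (x - x₀) = ptY y₀ α₁ α₂ m := by rw [ptY, hX, ptX]; ring
      rw [hY, hX]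
      exact nonsingular_pt x₀ y₀ α₁ α₂ hmα.1 hmα.2
    · apply hx'
      rw [not_and_or, not_ne_iff, not_ne_iff] at hmα
      rcases hmα with rfl | rfl
      · linear_combination hxm
      · linear_combination hxm

/-- **An endomorphism of the field fixing the singular model fixes its singular point and
permutes its tangent slopes.**  If `g : k → k` is a ring homomorphism with
`(singularModel x₀ y₀ α₁ α₂).map g = singularModel x₀ y₀ α₁ α₂`, then `g x₀ = x₀`, `g y₀ = y₀`
(the image of the singular point is a singular point, which is unique), and either
`g α₁ = α₁, g α₂ = α₂` or `g α₁ = α₂, g α₂ = α₁` (`g` fixes `a₁ = -(α₁ + α₂)` and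
`a₂ = -α₁α₂ - 3x₀`, so permutes the roots of the tangent cone `T² + a₁T - (a₂ + 3x₀)`).  For the
reduction of a Weierstrass equation over a local field and `g` the Frobenius of the residue field
the two cases are the split and the non-split node (Silverman, *AEC*, VII.§5, Exercise 3.5(a)).
[cite: SilvermanAEC2009, Prop. III.1.4(a), Exercise 3.5(a) and VII.§5 (PDF pp. 59, 97, 174)] -/
theorem apply_eq_of_map_eq {g : k →+* k}
    (hg : (singularModel x₀ y₀ α₁ α₂).map g = singularModel x₀ y₀ α₁ α₂) :
    g x₀ = x₀ ∧ g y₀ = y₀ ∧ ((g α₁ = α₁ ∧ g α₂ = α₂) ∨ (g α₁ = α₂ ∧ g α₂ = α₁)) := by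
  -- the image of `S` is a singular solution of the (fixed) curve, hence `S`
  have hE : (singularModel x₀ y₀ α₁ α₂).toAffine.Equation (g x₀) (g y₀) := by
    have := (Affine.map_equation (singularModel x₀ y₀ α₁ α₂) g.injective x₀ y₀).mpr
      ((equation_x₀_iff x₀ y₀ α₁ α₂ y₀).mpr rfl)
    have hg' : Affine.map (singularModel x₀ y₀ α₁ α₂) g = (singularModel x₀ y₀ α₁ α₂).toAffine := hg
    rwa [hg'] at this
  have hS : ¬ (singularModel x₀ y₀ α₁ α₂).toAffine.Nonsingular (g x₀) (g y₀) := by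
    intro h
    have h' : ((singularModel x₀ y₀ α₁ α₂).map g).toAffine.Nonsingular (g x₀) (g y₀) := by
      rwa [hg]
    exact not_nonsingular_S x₀ y₀ α₁ α₂
      ((Affine.map_nonsingular (singularModel x₀ y₀ α₁ α₂) g.injective x₀ y₀).mp h')
  obtain ⟨hx, hy⟩ := eq_of_equation_of_not_nonsingular hE hS
  refine ⟨hx, hy, ?_⟩
  -- `g` fixes the elementary symmetric functions of the slopes
  have h1 : g α₁ + g α₂ = α₁ + α₂ := by
    have := congrArg WeierstrassCurve.a₁ hg
    simp only [map, singularModel, map_neg, map_add] at this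
    linear_combination -this
  have h2 : g α₁ * g α₂ = α₁ * α₂ := by
    have := congrArg WeierstrassCurve.a₂ hg
    simp only [map, singularModel, map_sub, map_neg, map_mul, map_ofNat, hx] at this
    linear_combination -this
  have hroot : (g α₁ - α₁) * (g α₁ - α₂) = 0 := by
    linear_combination (g α₁) * h1 - h2
  rcases mul_eq_zero.mp hroot with h | h
  · left
    exact ⟨sub_eq_zero.mp h, by linear_combination h1 - sub_eq_zero.mp h⟩
  · right
    exact ⟨sub_eq_zero.mp h, by linear_combination h1 - sub_eq_zero.mp h⟩

end singularModel

end WeierstrassCurve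

end
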